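import Mathlib
import HarnessLib
import Summits.Ventures.LatticeQCDFlow.Exactness.IMHKernel

/-!
# Use the rejected proposal too: the acceptance-weighted ("waste-recycling", Rao–Blackwellised) read-out `α·f(Y) + (1 − α)·f(X)` of the flow
# sampler is exactly unbiased at equilibrium and never noisier than one exact sample, on a general state space

HONEST FRAMING: exact (Metropolis-corrected) sampling algorithms for lattice gauge theory;
figures of merit are autocorrelation/cost numbers at stated couplings and volumes; no
continuum-physics claim.

Venture `LatticeQCDFlow` (cell pub-lqcd), topic `Exactness`; FANOUT row 30 (lean-1, GEN-42).  NEW WORK of the cell over the tree's `IMHKernel`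
(`indepMH`, `imhAcceptE`, `imhAcceptMass`, `indepMH_invariant`); the one-step integration formula is re-derived here (`lintegral_indepMH_step`, the
same computation as `IMHErgodicEveryStart.lintegral_indepMH`, kept local so that this file's import closure stays `IMHKernel` only).
The single-proposal counterpart of GEN-41's `IMHMultiProposalPoolEstimator` ∕ `…PoolReadoutVariance` (the pool-weighted read-out of the ensemble
sampler): here the "pool" is `{X, Y}` and the weights are the Metropolis acceptance `α = min(1, w(Y)/w(X))` and its complement.  Printed
counterparts, named only: waste-recycling Monte Carlo (Ceperley–Chester–Kalos 1977; Frenkel 2004), Rao–Blackwellisation of Metropolis–Hastings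
(Casella–Robert 1996); Delmas–Jourdain 2009 show the multi-step version CAN increase the asymptotic variance for Metropolis — the one-step
statements below are what holds unconditionally.

## Results (no `sorry`, no new definitions)
* `lintegral_indepMH_step`, `lintegral_one_sub_imhAcceptE` (`∫ (1 − a(x, y)) q(dy) = 1 − A(x)`), **`lintegral_recycle_eq_kernel`** — for every measurable `g ≥ 0`:
  `∫ [a(x, y)g(y) + (1 − a(x, y))g(x)] q(dy) = ∫ g dK(x, ·)`: the recycled read-out is the conditional expectation of the next state's `g`.
* **`recycle_unbiased`** — `∫∫ [a(x, y)g(y) + (1 − a(x, y))g(x)] q(dy) π(dx) = ∫ g dπ` for `π = w·q`: AT EQUILIBRIUM THE RECYCLED READ-OUT IS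
  EXACTLY UNBIASED, for every positive measurable weight and every flow.
* `sq_convex_comb_le` (`(αa + (1 − α)b − θ)² ≤ α(a − θ)² + (1 − α)(b − θ)²` for `α ∈ [0, 1]`), **`recycle_sq_le`** — for real `f` and any constant
  `θ`: `∫∫ (a f(y) + (1 − a) f(x) − θ)² dq dπ ≤ ∫ (f − θ)² dπ` (in `ℝ≥0∞`): at `θ = π f` THE RECYCLED READ-OUT HAS SECOND MOMENT ABOUT `π f` AT MOST
  `Var_π f` — never noisier than reporting `f` at one exact sample, and it uses the weight evaluation already paid for the rejected proposal.
Reading (gauge files): after each accept/reject step of the exact flow sampler report `α·O(U') + (1 − α)·O(U)` instead of `O` at the new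
configuration; in equilibrium this is unbiased for `⟨O⟩` with no more variance per step.  NOT CLAIMED: multi-step (time-averaged) variance
orderings (false in general for Metropolis, Delmas–Jourdain), anything away from equilibrium.
-/

noncomputable section

namespace Summit.Ventures.LatticeQCDFlow.Exactness

open MeasureTheory ProbabilityTheory
open scoped ENNReal

variable {Ω : Type*} [MeasurableSpace Ω] {q : Measure Ω} [IsProbabilityMeasure q] {w : Ω → ℝ}

/-- Integration against one step of the independence kernel: `∫ g dK(z, ·) = ∫ a(z, y) g(y) q(dy) + (1 − A(z)) g(z)` (the computation of
`IMHErgodicEveryStart.lintegral_indepMH`, restated to keep the import closure small). [ours, bookkeeping] -/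
theorem lintegral_indepMH_step (hw : Measurable w) (z : Ω) {g : Ω → ℝ≥0∞} (hg : Measurable g) :
    ∫⁻ y, g y ∂(indepMH q w z) = ∫⁻ y, imhAcceptE w z y * g y ∂q + (1 - imhAcceptMass q w z) * g z := by
  have h2 : Measurable (Function.uncurry fun (x : Ω) (_ : Ω) => 1 - imhAcceptMass q w x) :=
    measurable_const.sub ((measurable_imhAcceptMass q hw).comp measurable_fst)
  rw [indepMH, Kernel.add_apply, lintegral_add_measure,
    Kernel.withDensity_apply _ (measurable_imhAcceptE hw), Kernel.const_apply,
    lintegral_withDensity_eq_lintegral_mul _ (measurable_imhAcceptE hw).of_uncurry_left hg,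
    Kernel.withDensity_apply _ h2, Kernel.deterministic_apply, id, withDensity_const,
    lintegral_smul_measure, lintegral_dirac' _ hg, smul_eq_mul]
  rfl

/-- `∫ (1 − a(x, y)) q(dy) = 1 − A(x)`. [ours, bookkeeping] -/
theorem lintegral_one_sub_imhAcceptE (hw : Measurable w) (x : Ω) :
    ∫⁻ y, (1 - imhAcceptE w x y) ∂q = 1 - imhAcceptMass q w x := by
  have hfin : ∫⁻ y, imhAcceptE w x y ∂q ≠ ⊤ := ne_top_of_le_ne_top ENNReal.one_ne_top (imhAcceptMass_le_one q w x)
  rw [lintegral_sub (measurable_imhAcceptE hw).of_uncurry_left hfin (ae_of_all _ fun y => imhAcceptE_le_one w x y), lintegral_const,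
    measure_univ, mul_one]
  rfl

/-- **THE RECYCLED READ-OUT IS THE ONE-STEP CONDITIONAL EXPECTATION**: `∫ [a(x, y)g(y) + (1 − a(x, y))g(x)] q(dy) = ∫ g dK(x, ·)` for the
independence kernel `K = indepMH q w` and every measurable `g ≥ 0`. [ours] -/
theorem lintegral_recycle_eq_kernel (hw : Measurable w) (x : Ω) {g : Ω → ℝ≥0∞} (hg : Measurable g) :
    ∫⁻ y, (imhAcceptE w x y * g y + (1 - imhAcceptE w x y) * g x) ∂q = ∫⁻ y, g y ∂(indepMH q w x) := by
  have ha : Measurable fun y => imhAcceptE w x y := (measurable_imhAcceptE hw).of_uncurry_left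
  rw [lintegral_indepMH_step hw x hg, lintegral_add_left (show Measurable (fun y => imhAcceptE w x y * g y) from ha.mul hg),
    lintegral_mul_const _ (show Measurable (fun y => 1 - imhAcceptE w x y) from measurable_const.sub ha), lintegral_one_sub_imhAcceptE hw x]

/-- **UNBIASED AT EQUILIBRIUM**: `∫∫ [a(x, y)g(y) + (1 − a(x, y))g(x)] q(dy) π(dx) = ∫ g dπ` for `π = w·q`, every positive measurable weight and
every measurable `g ≥ 0`. [ours] -/
theorem recycle_unbiased (hw : Measurable w) (hw0 : ∀ x, 0 < w x) {g : Ω → ℝ≥0∞} (hg : Measurable g) :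
    ∫⁻ x, ∫⁻ y, (imhAcceptE w x y * g y + (1 - imhAcceptE w x y) * g x) ∂q ∂(q.withDensity fun x => ENNReal.ofReal (w x)) =
      ∫⁻ x, g x ∂(q.withDensity fun x => ENNReal.ofReal (w x)) := by
  simp_rw [lintegral_recycle_eq_kernel hw _ hg]
  have hinv := (indepMH_invariant (q := q) hw hw0).def
  rw [← Measure.lintegral_bind (Kernel.aemeasurable _) hg.aemeasurable, hinv]

/-- Convexity of the square: `(αa + (1 − α)b − θ)² ≤ α(a − θ)² + (1 − α)(b − θ)²` for `0 ≤ α ≤ 1`. [folklore] -/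
theorem sq_convex_comb_le {α a b θ : ℝ} (h0 : 0 ≤ α) (h1 : α ≤ 1) :
    (α * a + (1 - α) * b - θ) ^ 2 ≤ α * (a - θ) ^ 2 + (1 - α) * (b - θ) ^ 2 := by
  nlinarith [mul_nonneg (mul_nonneg h0 (sub_nonneg.2 h1)) (sq_nonneg (a - b))]

/-- **NEVER NOISIER THAN ONE EXACT SAMPLE**: for a real observable `f`, every constant `θ` and `π = w·q`,
`∫∫ (a(x, y)f(y) + (1 − a(x, y))f(x) − θ)² q(dy) π(dx) ≤ ∫ (f − θ)² dπ` (as `ℝ≥0∞` integrals of the nonnegative squares).  At `θ = π f`: the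
recycled read-out's second moment about `π f` is at most `Var_π f`. [ours] -/
theorem recycle_sq_le (hw : Measurable w) (hw0 : ∀ x, 0 < w x) {f : Ω → ℝ} (hf : Measurable f) (θ : ℝ) :
    ∫⁻ x, ∫⁻ y, ENNReal.ofReal ((imhAccept w x y * f y + (1 - imhAccept w x y) * f x - θ) ^ 2) ∂q ∂(q.withDensity fun x => ENNReal.ofReal (w x))
      ≤ ∫⁻ x, ENNReal.ofReal ((f x - θ) ^ 2) ∂(q.withDensity fun x => ENNReal.ofReal (w x)) := by
  have hG : Measurable fun x => ENNReal.ofReal ((f x - θ) ^ 2) := ((hf.sub measurable_const).pow_const 2).ennreal_ofReal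
  rw [← recycle_unbiased hw hw0 hG]
  refine lintegral_mono fun x => lintegral_mono fun y => ?_
  have ha0 : 0 ≤ imhAccept w x y := imhAccept_nonneg hw0 x y
  have ha1 : imhAccept w x y ≤ 1 := imhAccept_le_one w x y
  calc ENNReal.ofReal ((imhAccept w x y * f y + (1 - imhAccept w x y) * f x - θ) ^ 2)
      ≤ ENNReal.ofReal (imhAccept w x y * (f y - θ) ^ 2 + (1 - imhAccept w x y) * (f x - θ) ^ 2) :=
        ENNReal.ofReal_le_ofReal (sq_convex_comb_le ha0 ha1)
    _ = imhAcceptE w x y * ENNReal.ofReal ((f y - θ) ^ 2) + (1 - imhAcceptE w x y) * ENNReal.ofReal ((f x - θ) ^ 2) := by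
        rw [ENNReal.ofReal_add (mul_nonneg ha0 (sq_nonneg _)) (mul_nonneg (sub_nonneg.2 ha1) (sq_nonneg _)),
          ENNReal.ofReal_mul ha0, ENNReal.ofReal_mul (sub_nonneg.2 ha1), ENNReal.ofReal_sub _ ha0, ENNReal.ofReal_one]
        rfl

end Summit.Ventures.LatticeQCDFlow.Exactness
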